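import Mathlib
import Summits.Schanuel.Schanuel.Statement
import Literature.NumberTheory.Transcendental.LindemannWeierstrassProofs
import Literature.NumberTheory.Transcendental.GelfondExpLogConjectureProofs
import HarnessLib

/-!
# Schanuel's conjecture: the complex-conjugation rung

`Summits/Schanuel/Schanuel/Theorems/SoloBlindConjugationRung.lean` (soloist `solo-Schanuel-blind`;
namespace `Summit.Schanuel.Schanuel.Theorems.ConjugationRung`).

**Theorem (conjugation rung, proved here, sorry-free).** Let `ρ ∈ ℂ` be transcendental with
`conj ρ = ρ` or `conj ρ = -ρ` (e.g. `ρ = π`, `ρ = iπ`, any real transcendental number), and let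
`α₁, …, αₙ` be algebraic numbers such that the `2n` numbers `α₁, …, αₙ, conj α₁, …, conj αₙ` are
linearly independent over `ℚ`. Then `ρ, e^{α₁}, …, e^{αₙ}` are algebraically independent over `ℚ`
(`algebraicIndependent_cons_exp_of_conj`). Consequences:

* `schanuel_at_cons_pi_mul_I` — **Schanuel's conjecture holds at every tuple
  `z = (iπ, α₁, …, αₙ)`** of this kind: `n + 1 ≤ trdeg_ℚ ℚ(z, e^z)` (the summit's own format;
  e.g. `z = (iπ, 1 + i)`, `z = (iπ, 1 + i, √2 + i√3)`);
* `algebraicIndependent_pi_exp` — for every algebraic `α ∉ ℝ ∪ iℝ`, **`π` and `e^α` are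
  algebraically independent** (e.g. `π` and `e^{1+i} = e·e^{i}`);
* `algebraicIndependent_cons_exp_of_real` — the same with any real transcendental `ρ` in place of `π`.

*Proof.* Lindemann–Weierstrass (the tree's proved `LindemannWeierstrass.AlgIndep_holds`; the
transcendence of `π` and `iπ` is taken from `LindemannWeierstrass.transcendental_pi_of_sumForm` and
`Literature.NumberTheory.Transcendental.transcendental_pi_mul_I`) makes the
`2n` numbers `e^{αᵢ}, e^{conj αᵢ} = conj e^{αᵢ}` algebraically independent. In the matroid of
algebraic independence over `ℚ` (Mathlib's `AlgebraicIndependent.matroid`), if `ρ` were algebraic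
over `ℚ[e^{α}]` then, applying complex conjugation (a field automorphism of `ℂ` commuting with
`exp` and fixing `ρ` up to sign), `ρ` would also be algebraic over `ℚ[e^{conj α}]`; for the
independent set `S ∪ T`, `S = {e^{αᵢ}}`, `T = {e^{conj αᵢ}}`, one has `cl S ∩ cl T = cl (S ∩ T) = cl ∅`
(`Matroid.Indep.closure_inter_eq_inter_closure`), so `ρ` would be algebraic — contradiction.

*Scope (why this is a rung and not a path).* The lever is an automorphism of `ℂ` commuting with
`exp`; complex conjugation is the only one known (its existence of others is open), and its fixed
field is `ℝ`: for real `αᵢ` the hypothesis fails (`rank ⟨α, conj α⟩ = n`), so the benchmark cases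
of rank `2` — `(1, iπ)` (`e, π`), `(1, e)` (`e, e^e`), `(log 2, log 3)` — are exactly out of reach.
It is the characteristic-`0` shadow of L. Denis's automorphism method for the Carlitz module
(`T ↦ ξT` on `𝔽_q[T]`, `q ≥ 3`), which proves the Carlitz analogue of the independence of `e`
and `π` [Denis, Acta Arith. 69 (1995) 75–89, Thm 3, Cor. 2(a)].

*Literature.* G. Diaz, *Utilisation de la conjugaison complexe dans l'étude de la transcendance de
valeurs de la fonction exponentielle*, J. Théor. Nombres Bordeaux 16 (2004) 535–553, uses complex
conjugation for **transcendence** statements (Hermite–Lindemann restricted, cases of the four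
exponentials conjecture, §5 "deux cas particuliers de la conjecture de Schanuel") but does not
record the algebraic-independence statement above; nor do Waldschmidt, *Diophantine approximation
on linear algebraic groups* (2000) §1.4, pp. 15–16 (algebraic independence results beyond
Lindemann–Weierstrass: Gel'fond, Diaz) or Chudnovsky, *Contributions* (1984) Ch. 1 §2, p. 14.
We therefore record it with its (short) proof rather than as a citation. [folklore]
-/

noncomputable section

open Complex Set

namespace Summit.Schanuel.Schanuel.Theorems.ConjugationRung

open Literature.NumberTheory.Transcendental.LindemannWeierstrass
  (AlgIndep_holds SumForm_holds transcendental_pi_of_sumForm)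
open Literature.NumberTheory.Transcendental (transcendental_pi_mul_I)

/-- The complex conjugate of an algebraic number is algebraic (complex conjugation is the
`ℚ`-algebra endomorphism `(starRingEnd ℂ).toRatAlgHom` of `ℂ`). [folklore] -/
theorem isAlgebraic_conj {z : ℂ} (hz : IsAlgebraic ℚ z) : IsAlgebraic ℚ ((starRingEnd ℂ) z) :=
  hz.algHom (starRingEnd ℂ).toRatAlgHom

/-- Transport of algebraicity over `ℚ[s]` along complex conjugation: if `a` is algebraic over
`ℚ[s]` then `conj a` is algebraic over `ℚ[conj s]`. [folklore] -/
theorem isAlgebraic_adjoin_conj {s : Set ℂ} {a : ℂ}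
    (ha : IsAlgebraic (Algebra.adjoin ℚ s) a) :
    IsAlgebraic (Algebra.adjoin ℚ ((starRingEnd ℂ) '' s)) ((starRingEnd ℂ) a) := by
  set φ : ℂ →ₐ[ℚ] ℂ := (starRingEnd ℂ).toRatAlgHom with hφ_def
  have hφ : ∀ z : ℂ, φ z = (starRingEnd ℂ) z := fun z => rfl
  set A : Subalgebra ℚ ℂ := Algebra.adjoin ℚ s
  set B : Subalgebra ℚ ℂ := Algebra.adjoin ℚ ((starRingEnd ℂ) '' s)
  have hAB : A.map φ = B := by
    simp only [A, B, AlgHom.map_adjoin]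
    rfl
  have hmem : ∀ x : A, φ (x : ℂ) ∈ B := fun x => by
    rw [← hAB]
    exact Subalgebra.mem_map.mpr ⟨x, x.2, rfl⟩
  let e : A →ₐ[ℚ] B := (φ.comp A.val).codRestrict B (fun x => hmem x)
  have he : Function.Injective e := by
    intro x y hxy
    have h1 : ((e x : B) : ℂ) = ((e y : B) : ℂ) := by rw [hxy]
    have h2 : (starRingEnd ℂ) (x : ℂ) = (starRingEnd ℂ) (y : ℂ) := h1
    exact Subtype.ext ((starRingEnd ℂ).injective h2)
  have hcomp : (algebraMap B ℂ).comp (e : A →+* B) =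
      (starRingEnd ℂ).comp (algebraMap A ℂ) := by
    ext x
    rfl
  exact ha.ringHom_of_comp_eq (e : A →+* B) (starRingEnd ℂ) he hcomp

/-- **Conjugation rung (core).** If `ρ` is transcendental with `conj ρ = ±ρ`, and `α₁, …, αₙ` are
algebraic with `α₁, …, αₙ, conj α₁, …, conj αₙ` linearly independent over `ℚ`, then
`ρ, e^{α₁}, …, e^{αₙ}` are algebraically independent over `ℚ`. [folklore] -/
theorem algebraicIndependent_cons_exp_of_conj {n : ℕ} {ρ : ℂ}
    (hρ : (starRingEnd ℂ) ρ = ρ ∨ (starRingEnd ℂ) ρ = -ρ) (hρt : Transcendental ℚ ρ)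
    (α : Fin n → ℂ) (halg : ∀ i, IsAlgebraic ℚ (α i))
    (hli : LinearIndependent ℚ (Sum.elim α ((starRingEnd ℂ) ∘ α))) :
    AlgebraicIndependent ℚ (Fin.cons ρ (cexp ∘ α) : Fin (n + 1) → ℂ) := by
  classical
  -- Lindemann–Weierstrass for the doubled family `(α, conj α)`.
  have halg2 : ∀ i, IsAlgebraic ℚ (Sum.elim α ((starRingEnd ℂ) ∘ α) i) := by
    rintro (i | i)
    · exact halg i
    · exact isAlgebraic_conj (halg i)
  have hLW := AlgIndep_holds.algebraicIndependent _ halg2 hli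
  set f : Fin n → ℂ := cexp ∘ α with hf_def
  set g : Fin n → ℂ := (starRingEnd ℂ) ∘ f with hg_def
  have hfg : cexp ∘ Sum.elim α ((starRingEnd ℂ) ∘ α) = Sum.elim f g := by
    funext i
    rcases i with i | i
    · rfl
    · simp [f, g, Complex.exp_conj]
  rw [hfg] at hLW
  -- The matroid of algebraic independence over `ℚ` in `ℂ`.
  set M := AlgebraicIndependent.matroid ℚ ℂ with hM_def
  have hinj : Function.Injective (Sum.elim f g) := hLW.injective
  have hindep : M.Indep (range f ∪ range g) := by
    rw [AlgebraicIndependent.matroid_indep_iff, ← Set.Sum.elim_range]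
    exact (algebraicIndependent_subtype_range hinj).mpr hLW
  have hdisj : range f ∩ range g = ∅ := by
    ext x
    simp only [mem_inter_iff, mem_range, mem_empty_iff_false, iff_false, not_and]
    rintro ⟨i, rfl⟩ ⟨j, hj⟩
    have h' : Sum.elim f g (Sum.inr j) = Sum.elim f g (Sum.inl i) := by simpa using hj
    exact Sum.inr_ne_inl (hinj h')
  have hmem : ∀ (s : Set ℂ) (a : ℂ), a ∈ M.closure s ↔ IsAlgebraic (Algebra.adjoin ℚ s) a := by
    intro s a
    rw [hM_def, AlgebraicIndependent.matroid_closure_eq]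
    rfl
  -- Key step: `ρ` is not algebraic over `ℚ[e^{α}]`.
  have hρf : ρ ∉ M.closure (range f) := by
    intro h1
    have h1' : IsAlgebraic (Algebra.adjoin ℚ (range f)) ρ := (hmem _ _).mp h1
    have h2' : IsAlgebraic (Algebra.adjoin ℚ (range g)) ρ := by
      have ht := isAlgebraic_adjoin_conj h1'
      rw [← Set.range_comp] at ht
      rcases hρ with h | h
      · rwa [h] at ht
      · rw [h] at ht
        simpa using ht.neg
    have h2 : ρ ∈ M.closure (range g) := (hmem _ _).mpr h2'
    have h3 : ρ ∈ M.closure (range f ∩ range g) := by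
      rw [hindep.closure_inter_eq_inter_closure]
      exact ⟨h1, h2⟩
    rw [hdisj, Matroid.closure_empty] at h3
    have hloop : M.IsLoop ρ := Matroid.isLoop_iff.mpr h3
    have hdep : ¬ M.Indep {ρ} := (Matroid.singleton_not_indep (by simp [hM_def])).mpr hloop
    apply hdep
    rw [hM_def, AlgebraicIndependent.matroid_indep_iff]
    have hsing : AlgebraicIndependent ℚ (fun i : ({ρ} : Set ℂ) => (id (i : ℂ))) := by
      rw [algebraicIndependent_singleton_iff (⟨ρ, rfl⟩ : ({ρ} : Set ℂ))]
      simpa using hρt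
    exact hsing
  -- Conclusion: `(ρ, f)` is algebraically independent.
  have hf : AlgebraicIndependent ℚ f := by
    have h := hLW.comp Sum.inl Sum.inl_injective
    simpa using h
  have hopt : AlgebraicIndependent ℚ (fun o : Option (Fin n) => o.elim ρ f) := by
    rw [hf.option_iff_transcendental]
    intro halgρ
    exact hρf ((hmem _ _).mpr halgρ)
  have hfin := hopt.comp (finSuccEquiv n) (finSuccEquiv n).injective
  convert hfin using 1
  funext i
  refine Fin.cases ?_ (fun j => ?_) i
  · simp
  · simp

/-- **Conjugation rung, real form.** For every real transcendental `ρ` and algebraic `α₁, …, αₙ`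
with `α, conj α` of `ℚ`-rank `2n`: `ρ, e^{α₁}, …, e^{αₙ}` are algebraically independent.
[folklore] -/
theorem algebraicIndependent_cons_exp_of_real {n : ℕ} (ρ : ℝ) (hρ : Transcendental ℚ ρ)
    (α : Fin n → ℂ) (halg : ∀ i, IsAlgebraic ℚ (α i))
    (hli : LinearIndependent ℚ (Sum.elim α ((starRingEnd ℂ) ∘ α))) :
    AlgebraicIndependent ℚ (Fin.cons (ρ : ℂ) (cexp ∘ α) : Fin (n + 1) → ℂ) := by
  have hρC : Transcendental ℚ (ρ : ℂ) := by
    have h := (transcendental_algebraMap_iff (R := ℚ) (A := ℂ) (a := ρ)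
      Complex.ofReal_injective).mpr hρ
    simpa using h
  exact algebraicIndependent_cons_exp_of_conj (Or.inl (Complex.conj_ofReal ρ)) hρC α halg hli

/-- **Schanuel's conjecture at the tuples `(iπ, α₁, …, αₙ)`**, `αᵢ` algebraic with
`α₁, …, αₙ, conj α₁, …, conj αₙ` linearly independent over `ℚ`: in the summit's own format,
`n + 1 ≤ trdeg_ℚ ℚ(z, e^z)` for `z = (iπ, α)`. [folklore] -/
theorem schanuel_at_cons_pi_mul_I {n : ℕ} (α : Fin n → ℂ) (halg : ∀ i, IsAlgebraic ℚ (α i))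
    (hli : LinearIndependent ℚ (Sum.elim α ((starRingEnd ℂ) ∘ α))) :
    ((n + 1 : ℕ) : Cardinal) ≤ Algebra.trdeg ℚ ↥(IntermediateField.adjoin ℚ
      (Set.range (Fin.cons ((Real.pi : ℂ) * I) α : Fin (n + 1) → ℂ) ∪
       Set.range (cexp ∘ (Fin.cons ((Real.pi : ℂ) * I) α : Fin (n + 1) → ℂ)))) := by
  set z : Fin (n + 1) → ℂ := Fin.cons ((Real.pi : ℂ) * I) α with hz_def
  have hconj : (starRingEnd ℂ) ((Real.pi : ℂ) * I) = (Real.pi : ℂ) * I ∨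
      (starRingEnd ℂ) ((Real.pi : ℂ) * I) = -((Real.pi : ℂ) * I) := Or.inr (by simp)
  have hw : AlgebraicIndependent ℚ (Fin.cons ((Real.pi : ℂ) * I) (cexp ∘ α) : Fin (n + 1) → ℂ) :=
    algebraicIndependent_cons_exp_of_conj hconj transcendental_pi_mul_I α halg hli
  set K := IntermediateField.adjoin ℚ (Set.range z ∪ Set.range (cexp ∘ z)) with hK_def
  have hmemK : ∀ i, (Fin.cons ((Real.pi : ℂ) * I) (cexp ∘ α) : Fin (n + 1) → ℂ) i ∈ K := by
    intro i
    refine Fin.cases ?_ (fun j => ?_) i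
    · exact IntermediateField.subset_adjoin ℚ _ (Or.inl ⟨0, by simp [z]⟩)
    · exact IntermediateField.subset_adjoin ℚ _ (Or.inr ⟨j.succ, by simp [z]⟩)
  let w' : Fin (n + 1) → K := fun i => ⟨_, hmemK i⟩
  have hw' : AlgebraicIndependent ℚ w' := AlgebraicIndependent.of_comp K.val (by exact hw)
  simpa using hw'.cardinalMk_le_trdeg

/-- `α` and `conj α` are linearly independent over `ℚ` as soon as `α ∉ ℝ ∪ iℝ`. [folklore] -/
theorem linearIndependent_pair_conj {α : ℂ} (hre : α.re ≠ 0) (him : α.im ≠ 0) :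
    LinearIndependent ℚ (Sum.elim ![α] ((starRingEnd ℂ) ∘ ![α])) := by
  rw [Fintype.linearIndependent_iff]
  intro c hc
  simp only [Fintype.sum_sum_type, Finset.univ_unique, Fin.default_eq_zero, Finset.sum_singleton,
    Sum.elim_inl, Matrix.cons_val_fin_one, Sum.elim_inr, Function.comp_apply] at hc
  set a := c (Sum.inl 0) with ha_def
  set b := c (Sum.inr 0) with hb_def
  simp only [Rat.smul_def] at hc
  have hre' := congrArg Complex.re hc
  have him' := congrArg Complex.im hc
  simp only [Complex.add_re, Complex.add_im, Complex.mul_re, Complex.mul_im, Complex.ratCast_re,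
    Complex.ratCast_im, Complex.conj_re, Complex.conj_im, Complex.zero_re, Complex.zero_im,
    zero_mul, sub_zero, add_zero, mul_neg] at hre' him'
  have h1 : ((a : ℝ) + b) * α.re = 0 := by linear_combination hre'
  have h2 : ((a : ℝ) - b) * α.im = 0 := by linear_combination him'
  have h1' : (a : ℝ) + b = 0 := (mul_eq_zero.mp h1).resolve_right hre
  have h2' : (a : ℝ) - b = 0 := (mul_eq_zero.mp h2).resolve_right him
  have ha0 : (a : ℝ) = 0 := by linarith
  have hb0 : (b : ℝ) = 0 := by linarith
  have ha0' : a = 0 := by exact_mod_cast ha0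
  have hb0' : b = 0 := by exact_mod_cast hb0
  rintro (i | i)
  · fin_cases i
    exact ha0'
  · fin_cases i
    exact hb0'

/-- **`π` and `e^α` are algebraically independent for every algebraic `α ∉ ℝ ∪ iℝ`**
(e.g. `α = 1 + i`). [folklore] -/
theorem algebraicIndependent_pi_exp {α : ℂ} (hα : IsAlgebraic ℚ α) (hre : α.re ≠ 0)
    (him : α.im ≠ 0) : AlgebraicIndependent ℚ ![(Real.pi : ℂ), cexp α] := by
  have halg : ∀ i, IsAlgebraic ℚ ((![α] : Fin 1 → ℂ) i) := fun i => by
    fin_cases i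
    simpa using hα
  have h := algebraicIndependent_cons_exp_of_real Real.pi (transcendental_pi_of_sumForm SumForm_holds)
    ![α] halg (linearIndependent_pair_conj hre him)
  convert h using 1
  funext i
  refine Fin.cases ?_ (fun j => ?_) i
  · simp
  · fin_cases j
    simp

/-- Example: `π` and `e^{1+i}` are algebraically independent over `ℚ`. [folklore] -/
theorem algebraicIndependent_pi_exp_one_add_I :
    AlgebraicIndependent ℚ ![(Real.pi : ℂ), cexp (1 + I)] := by
  have hI : IsAlgebraic ℚ I := by
    refine ⟨Polynomial.X ^ 2 + 1, Polynomial.Monic.ne_zero (by monicity!), ?_⟩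
    simp
  exact algebraicIndependent_pi_exp (isAlgebraic_one.add hI) (by simp) (by simp)

end Summit.Schanuel.Schanuel.Theorems.ConjugationRung
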